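import Mathlib
import HarnessLib.Audit
import Summits.PneNP.PneNP.Theorems.PstarChordReadPairCore
import Summits.PneNP.PneNP.Theorems.PstarGapTwoTerminal

/-!
# Empty-core coincidences have rank below six (ROUND-24, O1 at exact tightness; memo g21 §17.5)

FRONTIER range-avoidance ladder, rung F-N3, ROUND 24 (cell `pnp-ideate`, prover-2 memo `g21/O1-CHORD-READ-g21.md` §17.5; typed target
`PstarCoreBoundTargets.TerminalPeelable` (p646951); restricted-model proof complexity — nothing here bears on `P` versus `NP`).

The pair-core normalisation (`PstarTwoCoreNormal`, `PstarPairCoreNormal`) ends either in a genuine terminal sub-core or in an EMPTY-CORE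
COINCIDENCE: two G-constraints `e₁ = (C₁, G₁, b₁)`, `e₂ = (C₂, G₂, b₂)` with NO common solution over all of `𝔽₂ⁿ`, each satisfiable, and with the
per-monomial flip property.  This file bounds such coincidences by RANK RIGIDITY (`PstarRankRigidity.eq_zero_or_eq_of_rank_six`):

* `gfn I e` — the G-constraint as an `𝔽₂`-valued function on `𝔽₂ⁿ` (`Σ_{C} x_v + Σ_{G} x_{p_g} x_{q_g} + b`, zero exactly where `e` holds:
  `gfn_bit_eq_zero_iff`); it is quadratic with polar form the adjacency form `PstarProductRank.polar` of the AND pairs of `G` (`gfn_add`).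
* **`eq_of_coincidence_of_rank_six`** — if `e₁ ∧ e₂` is unsatisfiable over all assignments, `e₂` is satisfiable, and the polar form of `e₁` has
  rank `≥ 6` (radical of codimension `≥ 6`), then `e₂` is the COMPLEMENT of `e₁`: `C₁ = C₂`, `G₁ = G₂` and `e₂` holds exactly where `e₁` fails.
  (The indicator `gfn e₂ + 1` vanishes on `Z(gfn e₁)`, so it is `0` or `gfn e₁`; pure instance with simple overlaps, so a constant G-constraint
  is empty, `PstarGConstraint.eq_empty_of_gval_const`.)
* **`rank_lt_six_of_coincidence`** — hence if moreover some assignment violates BOTH constraints (the flip of a common monomial), the polar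
  form of `e₁` has rank `< 6`; symmetrically for `e₂` (`rank_lt_six_of_coincidence'`).

For the O1 chain: in the empty-core branch of `PairCore.normalForm` the `ℓ`-descendant is `(∅, F₁, β)` — the AND-sum `Σ_{f∈F₁} Q_f` of an XOR
edge set closing a cycle with the chord `c` — so a coincidence needs the AND-graph of `F₁` (and of `G ∪ F₂`) to have adjacency rank `≤ 4`:
at most two vertex-disjoint isolated AND pairs (`PstarProductRank.finrank_add_card_le`: an induced matching of three pairs gives rank `≥ 6`).
This is the kernel form of "the only defects are 3-cycles `{c, t, o}`" (memo §15.2).  No Assumption A.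
-/

set_option linter.dupNamespace false -- `Summit.PneNP.PneNP.…`: summit = sub-problem name (D-0017 single-conjunct layout)

open Finset Module Literature.Computability.Complexity
open scoped symmDiff
open Summit.PneNP.PneNP.Theorems.PstarSALevel (SimpleOverlap)
open Summit.PneNP.PneNP.Theorems.PstarFibrePolys (bit bit_xor bit_injective bit_add_bit_eq_zero_iff)
open Summit.PneNP.PneNP.Theorems.PstarGapOneAll (gval)
open Summit.PneNP.PneNP.Theorems.PstarGConstraint (bit_gval eq_empty_of_gval_const andPairs_simple)
open Summit.PneNP.PneNP.Theorems.PstarGSystemFreeVar (gval_symmDiff)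
open Summit.PneNP.PneNP.Theorems.PstarCubeIdeals (IsQuadFn)
open Summit.PneNP.PneNP.Theorems.PstarQuadRank (rad)
open Summit.PneNP.PneNP.Theorems.PstarProductRank (qform polar qform_add)
open Summit.PneNP.PneNP.Theorems.PstarRankRigidity (eq_zero_or_eq_of_rank_six)
open Summit.PneNP.PneNP.Theorems.PstarChordBridge (toBool bit_toBool)

namespace Summit.PneNP.PneNP.Theorems.PstarCoincidenceRank

variable {n m : ℕ}

/-! ## G-constraints as quadratic functions on `𝔽₂ⁿ` -/
section Gfn

variable (I : LocalMap 4 n m)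

/-- The G-constraint `e = (C, G, b)` as an `𝔽₂`-valued function on `𝔽₂ⁿ`: `Σ_{v∈C} x_v + Σ_{g∈G} x_{p_g}·x_{q_g} + b`.  It vanishes at
`bit ∘ z` exactly when `e` holds at `z`. -/
def gfn (e : Finset (Fin n) × Finset (Fin m) × Bool) (x : Fin n → ZMod 2) : ZMod 2 :=
  ∑ v ∈ e.1, x v + qform e.2.1 (fun j => I.vars j 2) (fun j => I.vars j 3) x + bit e.2.2

/-- `gfn` at a Boolean point. -/
theorem gfn_bit (e : Finset (Fin n) × Finset (Fin m) × Bool) (z : Fin n → Bool) :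
    gfn I e (fun v => bit (z v)) = bit (gval I e.1 e.2.1 z) + bit e.2.2 := by
  unfold gfn qform
  rw [bit_gval]

/-- In `𝔽₂`, `a + b = 0 ↔ a = b` for bits. -/
theorem gfn_bit_eq_zero_iff (e : Finset (Fin n) × Finset (Fin m) × Bool) (z : Fin n → Bool) :
    gfn I e (fun v => bit (z v)) = 0 ↔ gval I e.1 e.2.1 z = e.2.2 := by
  rw [gfn_bit, bit_add_bit_eq_zero_iff]

/-- Every point of `𝔽₂ⁿ` is a Boolean point. -/
theorem eq_bit_toBool (x : Fin n → ZMod 2) : x = fun v => bit (toBool (x v)) := by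
  funext v; rw [bit_toBool]

/-- **Polarisation**: `gfn e` is quadratic with polar form the adjacency form of the AND pairs of `G`. -/
theorem gfn_add (e : Finset (Fin n) × Finset (Fin m) × Bool) (x w : Fin n → ZMod 2) :
    gfn I e (x + w) = gfn I e x + gfn I e w + gfn I e 0 + polar e.2.1 (fun j => I.vars j 2) (fun j => I.vars j 3) x w := by
  unfold gfn
  have h0 : qform e.2.1 (fun j => I.vars j 2) (fun j => I.vars j 3) (0 : Fin n → ZMod 2) = 0 := by
    simp only [qform, Pi.zero_apply, mul_zero, sum_const_zero]
  have hlin : ∑ v ∈ e.1, (x + w) v = ∑ v ∈ e.1, x v + ∑ v ∈ e.1, w v := by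
    rw [← sum_add_distrib]; rfl
  have hbb : ∀ t : ZMod 2, t + t = 0 := by decide
  rw [qform_add, hlin, h0]
  simp only [Pi.zero_apply, sum_const_zero, zero_add, add_zero]
  have := hbb (bit e.2.2)
  linear_combination -this

/-- `gfn e` is a quadratic function. -/
theorem isQuadFn_gfn (e : Finset (Fin n) × Finset (Fin m) × Bool) : IsQuadFn (gfn I e) :=
  ⟨polar e.2.1 (fun j => I.vars j 2) (fun j => I.vars j 3), gfn_add I e⟩

/-- `gfn e + 1` is a quadratic function (same polar form). -/
theorem isQuadFn_gfn_add_one (e : Finset (Fin n) × Finset (Fin m) × Bool) : IsQuadFn (fun x => gfn I e x + 1) := by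
  refine ⟨polar e.2.1 (fun j => I.vars j 2) (fun j => I.vars j 3), fun x w => ?_⟩
  dsimp only
  rw [gfn_add]
  have hbb : ∀ t : ZMod 2, t + t = 0 := by decide
  linear_combination -(hbb 1)

end Gfn

/-! ## Coincidences of rank six are complements -/
section Coincidence

variable {I : LocalMap 4 n m}

/-- Two G-constraints agreeing up to a constant on all Boolean points have the same linear part and the same monomials (pure instance with
simple overlaps). -/
theorem eq_of_gval_iff_const (hI : I.IsPure xorAndPred) (hS : SimpleOverlap I) {C₁ C₂ : Finset (Fin n)} {G₁ G₂ : Finset (Fin m)} {κ : Bool}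
    (h : ∀ z : Fin n → Bool, gval I C₁ G₁ z = xor (gval I C₂ G₂ z) κ) : C₁ = C₂ ∧ G₁ = G₂ := by
  classical
  have hconst : ∀ z, gval I (C₁ ∆ C₂) (G₁ ∆ G₂) z = κ := fun z => by
    rw [gval_symmDiff, h z]
    cases gval I C₂ G₂ z <;> cases κ <;> rfl
  obtain ⟨hnd, hdist⟩ := andPairs_simple I hI hS (G₁ ∆ G₂)
  obtain ⟨hC, hG⟩ := eq_empty_of_gval_const I hnd hdist hconst
  exact ⟨symmDiff_eq_bot.1 hC, symmDiff_eq_bot.1 hG⟩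

/-- **A COINCIDENCE OF RANK SIX IS A COMPLEMENTARY PAIR.**  Pure instance with simple overlaps; `e₁ ∧ e₂` unsatisfiable over all assignments,
`e₂` satisfiable, and the polar form of `e₁` (the adjacency form of the AND pairs of `G₁`) of rank `≥ 6`.  Then `C₁ = C₂`, `G₁ = G₂`, and `e₂`
holds exactly where `e₁` fails. -/
theorem eq_of_coincidence_of_rank_six (hI : I.IsPure xorAndPred) (hS : SimpleOverlap I) {e₁ e₂ : Finset (Fin n) × Finset (Fin m) × Bool}
    (hU : ∀ z : Fin n → Bool, ¬ (gval I e₁.1 e₁.2.1 z = e₁.2.2 ∧ gval I e₂.1 e₂.2.1 z = e₂.2.2))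
    (hS₂ : ∃ z : Fin n → Bool, gval I e₂.1 e₂.2.1 z = e₂.2.2)
    (hrank : finrank (ZMod 2) (rad (polar e₁.2.1 (fun j => I.vars j 2) (fun j => I.vars j 3))) + 6 ≤ finrank (ZMod 2) (Fin n → ZMod 2)) :
    e₁.1 = e₂.1 ∧ e₁.2.1 = e₂.2.1 ∧ ∀ z : Fin n → Bool, gval I e₂.1 e₂.2.1 z = e₂.2.2 ↔ gval I e₁.1 e₁.2.1 z ≠ e₁.2.2 := by
  classical
  -- `gfn e₂ + 1` vanishes on `Z(gfn e₁)`
  have hZ : ∀ x : Fin n → ZMod 2, gfn I e₁ x = 0 → gfn I e₂ x + 1 = 0 := by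
    intro x hx
    rw [eq_bit_toBool x] at hx ⊢
    rw [gfn_bit_eq_zero_iff] at hx
    have h2 : gfn I e₂ (fun v => bit (toBool (x v))) ≠ 0 := fun h2 => hU _ ⟨hx, (gfn_bit_eq_zero_iff I e₂ _).1 h2⟩
    revert h2
    generalize gfn I e₂ (fun v => bit (toBool (x v))) = t
    revert t; decide
  rcases eq_zero_or_eq_of_rank_six (gfn_add I e₁) hrank (isQuadFn_gfn_add_one I e₂) hZ with h0 | hq
  · -- `e₂` never holds
    exfalso
    obtain ⟨z, hz⟩ := hS₂
    have h := h0 (fun v => bit (z v))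
    rw [← (gfn_bit_eq_zero_iff I e₂ z)] at hz
    rw [hz, zero_add] at h
    exact one_ne_zero h
  · -- `e₂ = ¬ e₁`
    have hpt : ∀ z : Fin n → Bool, gval I e₂.1 e₂.2.1 z = e₂.2.2 ↔ gval I e₁.1 e₁.2.1 z ≠ e₁.2.2 := by
      intro z
      have h := hq (fun v => bit (z v))
      rw [← gfn_bit_eq_zero_iff I e₂ z, ne_eq, ← gfn_bit_eq_zero_iff I e₁ z]
      revert h
      generalize gfn I e₂ (fun v => bit (z v)) = s
      generalize gfn I e₁ (fun v => bit (z v)) = t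
      revert s t; decide
    have hrel : ∀ z : Fin n → Bool, gval I e₂.1 e₂.2.1 z = xor (gval I e₁.1 e₁.2.1 z) (xor (!e₁.2.2) e₂.2.2) := by
      intro z
      have h := hpt z
      revert h
      cases gval I e₂.1 e₂.2.1 z <;> cases gval I e₁.1 e₁.2.1 z <;> cases e₁.2.2 <;> cases e₂.2.2 <;> simp
    obtain ⟨hC, hG⟩ := eq_of_gval_iff_const hI hS hrel
    exact ⟨hC.symm, hG.symm, hpt⟩

/-- **EMPTY-CORE COINCIDENCES HAVE RANK BELOW SIX.**  If `e₁ ∧ e₂` is unsatisfiable over all assignments, `e₂` is satisfiable, and some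
assignment violates both constraints, then the polar form of `e₁` has rank `< 6`. -/
theorem rank_lt_six_of_coincidence (hI : I.IsPure xorAndPred) (hS : SimpleOverlap I) {e₁ e₂ : Finset (Fin n) × Finset (Fin m) × Bool}
    (hU : ∀ z : Fin n → Bool, ¬ (gval I e₁.1 e₁.2.1 z = e₁.2.2 ∧ gval I e₂.1 e₂.2.1 z = e₂.2.2))
    (hS₂ : ∃ z : Fin n → Bool, gval I e₂.1 e₂.2.1 z = e₂.2.2)
    (hD : ∃ z : Fin n → Bool, gval I e₁.1 e₁.2.1 z ≠ e₁.2.2 ∧ gval I e₂.1 e₂.2.1 z ≠ e₂.2.2) :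
    finrank (ZMod 2) (Fin n → ZMod 2) < finrank (ZMod 2) (rad (polar e₁.2.1 (fun j => I.vars j 2) (fun j => I.vars j 3))) + 6 := by
  by_contra hge
  push Not at hge
  obtain ⟨-, -, hpt⟩ := eq_of_coincidence_of_rank_six hI hS hU hS₂ hge
  obtain ⟨z, hz₁, hz₂⟩ := hD
  exact hz₂ ((hpt z).2 hz₁)

/-- The symmetric statement: the polar form of `e₂` has rank `< 6` (given `e₁` satisfiable). -/
theorem rank_lt_six_of_coincidence' (hI : I.IsPure xorAndPred) (hS : SimpleOverlap I) {e₁ e₂ : Finset (Fin n) × Finset (Fin m) × Bool}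
    (hU : ∀ z : Fin n → Bool, ¬ (gval I e₁.1 e₁.2.1 z = e₁.2.2 ∧ gval I e₂.1 e₂.2.1 z = e₂.2.2))
    (hS₁ : ∃ z : Fin n → Bool, gval I e₁.1 e₁.2.1 z = e₁.2.2)
    (hD : ∃ z : Fin n → Bool, gval I e₁.1 e₁.2.1 z ≠ e₁.2.2 ∧ gval I e₂.1 e₂.2.1 z ≠ e₂.2.2) :
    finrank (ZMod 2) (Fin n → ZMod 2) < finrank (ZMod 2) (rad (polar e₂.2.1 (fun j => I.vars j 2) (fun j => I.vars j 3))) + 6 :=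
  rank_lt_six_of_coincidence hI hS (fun z h => hU z ⟨h.2, h.1⟩) hS₁ (by obtain ⟨z, h₁, h₂⟩ := hD; exact ⟨z, h₂, h₁⟩)

end Coincidence

end Summit.PneNP.PneNP.Theorems.PstarCoincidenceRank
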